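import Summits.AtomisticToContinuum.BoseEinsteinCondensation.Theorems.KineticLatticeBEC.Negative.FullFilling
import Summits.AtomisticToContinuum.BoseEinsteinCondensation.Theorems.KineticLatticeBEC.Negative.ParticleHole
import Summits.AtomisticToContinuum.BoseEinsteinCondensation.Theorems.KineticLatticeBEC.Negative.SectorSelection

/-!
# Negative lemmas for crux `KineticLatticeBEC` (stmt-AtomisticToContinuum-9671), VI: every fixed-hole
cap refuted; prover-facing helpers; `1 ≤ N` is not load-bearing

Supports (does not close) stmt-AtomisticToContinuum-9671. With the particle–hole identity and Tóth's bound: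
`kineticLatticeBEC_false_withHoleCap K : ¬ KineticLatticeBECWithHoleCap K` for every fixed `K` (cap
`N + K ≤ L³`; `rhs(L, L³−K) ≤ (K+1)L³` against `c(L³−K)L³`) — the filling hypothesis of the crux is
load-bearing exactly at linear order in `L³` (contrast `kineticLatticeBEC_iff_cap`). Prover-facing
helpers: `re_quad_obsO_eq_of_support` (in the sector `Re⟨v,Ov⟩ = ‖S⁺_tot v‖² + (N − L³/2)‖v‖²`) and the
lower-bound transfer `le_rhs_of_groundSpace_bound`. Finally `rhs_full : rhs(L,L³) = L³`,
`rhs_zero : rhs(L,0) = 0`, `crux_ineq_zero`: dropping `1 ≤ N` changes nothing.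
-/

noncomputable section

namespace Summit.AtomisticToContinuum.BoseEinsteinCondensation.Theorems.KineticLatticeBEC.Negative

open scoped BigOperators ComplexOrder
open Literature.MathematicalPhysics.QuantumLattice Literature.Probability.LatticeModels Matrix Finset
open Summit.AtomisticToContinuum.BoseEinsteinCondensation.Theses.BECStronglyRayleigh
open Summit.AtomisticToContinuum.BoseEinsteinCondensation.Theorems.LatticeODLROOffHalfFilling.Negative


/-- The crux with the half-filling cap `2N ≤ L³` replaced by a FIXED hole number: `N + K ≤ L³`.
-/
def KineticLatticeBECWithHoleCap (K : ℕ) : Prop :=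
  ∃ c : ℝ, 0 < c ∧ ∃ L₀ : ℕ, ∀ (L : ℕ) [NeZero L], L₀ ≤ L → Even L → ∀ N : ℕ, 1 ≤ N → N + K ≤ L ^ 3 →
    c * N * (L : ℝ) ^ 3 ≤ rhs L N

/-- **Every fixed-hole cap is refuted**: for each `K`, uniform BEC at all fillings `N ≤ L³ − K` is
FALSE — at `N = L³ − K`, `rhs = rhs(L,K) + L³ − 2K ≤ K(L³−K+1) + L³ − 2K ≤ (K+1)L³` (particle–hole
+ Tóth) against `c(L³ − K)L³`. The filling hypothesis is load-bearing at linear order in `L³`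
(contrast `kineticLatticeBEC_iff_cap`). [folklore] -/
theorem kineticLatticeBEC_false_withHoleCap (K : ℕ) : ¬ KineticLatticeBECWithHoleCap K := by
  rintro ⟨c, hc, L₀, h⟩
  obtain ⟨m, hm⟩ := exists_nat_gt ((K + 1) / c)
  set n : ℕ := L₀ + K + m + 2 with hn
  have hL0 : 2 * n ≠ 0 := by omega
  haveI : NeZero (2 * n) := ⟨hL0⟩
  have hL3 : 3 ≤ 2 * n := by omega
  have hcube : 2 * n ≤ (2 * n) ^ 3 := by
    calc 2 * n = (2 * n) ^ 1 := (pow_one _).symm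
      _ ≤ (2 * n) ^ 3 := Nat.pow_le_pow_right (by omega) (by norm_num)
  have hK : K + 1 ≤ (2 * n) ^ 3 := by omega
  have hN1 : 1 ≤ (2 * n) ^ 3 - K := by omega
  have hNK : (2 * n) ^ 3 - K + K ≤ (2 * n) ^ 3 := by omega
  have key := h (2 * n) (by omega) ⟨n, two_mul n⟩ ((2 * n) ^ 3 - K) hN1 hNK
  have hKle : K ≤ (2 * n) ^ 3 := by omega
  have hph := rhs_particle_hole (2 * n) hL3 (Nat.sub_le _ K)
  rw [Nat.sub_sub_self hKle] at hph
  have htoth := rhs_le_toth (2 * n) hL3 hKle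
  set x : ℝ := ((2 * n : ℕ) : ℝ) with hx
  have hcast : (((2 * n) ^ 3 - K : ℕ) : ℝ) = x ^ 3 - K := by
    rw [Nat.cast_sub hKle, Nat.cast_pow]
  rw [hcast] at key hph
  -- key : c (x³ − K) x³ ≤ rhs(L, L³−K) = rhs(L,K) + 2(x³−K) − x³ ≤ K(x³−K+1) + x³ − 2K
  have hxm : (K : ℝ) + m + 2 ≤ x := by
    rw [hx, hn]; push_cast; linarith
  have hK0 : (0 : ℝ) ≤ K := Nat.cast_nonneg _
  have hm0 : (0 : ℝ) ≤ m := Nat.cast_nonneg _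
  have hx1 : (1 : ℝ) ≤ x := by linarith
  have hx3 : x ≤ x ^ 3 := le_self_pow₀ hx1 (by norm_num)
  have hxpos : (0 : ℝ) < x ^ 3 := by positivity
  have hcm : (K : ℝ) + 1 < c * m := by
    rw [div_lt_iff₀ hc] at hm
    linarith
  -- rhs(L, L³ − K) ≤ (K + 1) x³
  have hbound : rhs (2 * n) ((2 * n) ^ 3 - K) ≤ ((K : ℝ) + 1) * x ^ 3 := by
    rw [hph]
    nlinarith
  -- c (x³ − K) x³ ≤ (K+1) x³  ⇒  c (x³ − K) ≤ K + 1
  have h1 : c * (x ^ 3 - K) ≤ K + 1 := by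
    have : x ^ 3 * (c * (x ^ 3 - K)) ≤ x ^ 3 * (K + 1) := by nlinarith
    exact le_of_mul_le_mul_left this hxpos
  -- but x³ − K ≥ x − K ≥ m + 2, so c (x³ − K) ≥ c (m + 2) > K + 1
  have h2 : (m : ℝ) + 2 ≤ x ^ 3 - K := by linarith
  nlinarith [mul_le_mul_of_nonneg_left h2 hc.le]


/-! ### §6 FOR THE PROVERS: the crux as a lower bound on `‖S⁺_tot v‖²` over sector ground vectors

By §5 every ground vector `v` of `H_pen(L,N)` lies in the `N`-sector, where
`Re⟨v, O v⟩ = ‖S⁺_tot v‖² + (N − L³/2)‖v‖²` (`re_quad_obsO_eq_of_support`), so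
`rhs(L,N) = avg_v ‖S⁺_tot v‖²/‖v‖² + 2N − L³` over the ground space (`= ‖S⁻_tot v‖²/‖v‖² = L³N₀` by
`[S⁺_tot, S⁻_tot] = 2S³_tot`). Positivity transfer turns any UNIFORM lower bound over ground vectors into
the crux (`kineticLatticeBEC_of_groundVector_bound`); the converse needs Perron uniqueness of the sector
ground state (support item `SectorGroundStatePerron`), since a tracial average does not bound each
ground vector. This positive reduction lives only in this work file (not on the Negative lane). -/

section Provers

variable (L : ℕ) [NeZero L]

/-- **In the sector, `Re⟨v, O v⟩ = ‖S⁺_tot v‖² + (N − L³/2)‖v‖²`.** [folklore] -/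
theorem re_quad_obsO_eq_of_support {N : ℕ} (hN : N ≤ L ^ 3) (v : TensorIndex (TorusSite 3 L) 2 → ℂ)
    (hv : ∀ τ, downCount τ ≠ L ^ 3 - N → v τ = 0) :
    (star v ⬝ᵥ (obsO (TorusSite 3 L)) *ᵥ v).re =
      (star ((∑ x, E x) *ᵥ v) ⬝ᵥ ((∑ x, E x) *ᵥ v)).re + ((N : ℝ) - (L : ℝ) ^ 3 / 2) * (star v ⬝ᵥ v).re := by
  rw [quad_obsO, Complex.add_re, re_quad_totalSpin_two, re_star_dotProduct_self v, Finset.mul_sum]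
  congr 1
  refine Finset.sum_congr rfl fun τ _ => ?_
  by_cases hτ : downCount τ = L ^ 3 - N
  · rw [hτ, card_site, Nat.cast_sub hN]
    push_cast
    ring
  · rw [hv τ hτ, norm_zero]
    simp

/-- **Lower-bound transfer.** If every ground vector `v` of `H_pen(L,N)` has `B‖v‖² ≤ ‖S⁺_tot v‖²`,
then `B + 2N − L³ ≤ rhs(L,N)` (`L ≥ 3`, `N ≤ L³`). [folklore] -/
theorem le_rhs_of_groundSpace_bound (hL : 3 ≤ L) {N : ℕ} (hN : N ≤ L ^ 3) {B : ℝ}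
    (h : ∀ v ∈ (Hpen L N).groundSpace,
      B * (star v ⬝ᵥ v).re ≤ (star ((∑ x, E x) *ᵥ v) ⬝ᵥ ((∑ x, E x) *ᵥ v)).re) :
    B + 2 * N - (L : ℝ) ^ 3 ≤ rhs L N := by
  have hT : ∀ v ∈ (Hpen L N).groundSpace,
      0 ≤ (star v ⬝ᵥ (obsO (TorusSite 3 L) -
        (((B + N - (L : ℝ) ^ 3 / 2 : ℝ)) : ℂ) • (1 : Op (TorusSite 3 L) 2)) *ᵥ v).re := by
    intro v hv
    have hq := re_quad_obsO_eq_of_support L hN v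
      (fun τ hτ => apply_eq_zero_of_mem_groundSpace L hL hN hv hτ)
    have hb := h v hv
    rw [sub_mulVec, dotProduct_sub, Complex.sub_re, smul_mulVec, one_mulVec, dotProduct_smul,
      smul_eq_mul, Complex.re_ofReal_mul, hq]
    nlinarith
  have h0 := re_gsf_nonneg_of_groundSpace hT
  rw [map_sub, map_smul, groundStateFunctional_one (Hpen_isHermitian L _), Complex.sub_re,
    smul_eq_mul, mul_one, Complex.ofReal_re] at h0
  rw [rhs]
  linarith

end Provers

/-! ### §7 The hypothesis `1 ≤ N` is NOT load-bearing: `rhs(L,L³) = L³` and `rhs(L,0) = 0` exactly -/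

section ZeroFilling

variable (L : ℕ) [NeZero L]

/-- **`rhs(L,L³) = L³` exactly** (`N₀ = 1` at full filling; `L ≥ 3`). [folklore] -/
theorem rhs_full (hL : 3 ≤ L) : rhs L (L ^ 3) = (L : ℝ) ^ 3 := by
  refine le_antisymm (rhs_full_le L hL) ?_
  have h := le_rhs_of_groundSpace_bound L hL (le_refl (L ^ 3)) (B := 0) (fun v _ => by
    rw [zero_mul]
    exact (Complex.nonneg_iff.mp (dotProduct_star_self_nonneg _)).1)
  push_cast at h
  linarith

/-- **`rhs(L,0) = 0`** (empty lattice; `L ≥ 3`), by particle–hole symmetry. [folklore] -/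
theorem rhs_zero (hL : 3 ≤ L) : rhs L 0 = 0 := by
  have h := rhs_particle_hole L hL (Nat.zero_le (L ^ 3))
  rw [Nat.sub_zero, rhs_full L hL] at h
  push_cast at h
  linarith

/-- The `N = 0` instance of the crux inequality is `0 ≤ 0`: dropping `1 ≤ N` changes nothing.
[folklore] -/
theorem crux_ineq_zero (hL : 3 ≤ L) (c : ℝ) : c * ((0 : ℕ) : ℝ) * (L : ℝ) ^ 3 ≤ rhs L 0 := by
  rw [rhs_zero L hL]
  simp

end ZeroFilling



end Summit.AtomisticToContinuum.BoseEinsteinCondensation.Theorems.KineticLatticeBEC.Negative
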